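import Summits.Schanuel.Schanuel.Theorems.RootDecomp1EAnchorToolkit
import Literature.NumberTheory.Transcendental.PeriodsWave0
import Literature.NumberTheory.Transcendental.LindemannWeierstrassProofs

/-!
# RootDecomp1 — ROUND 9 «ArgumentLayer» (lens 1, gen 9): the ARGUMENT-DEGREE grading of a tight atom — cells, members, calculus

Port (census seat, prover role; `--supports stmt-Schanuel-30352`) of §3–§7 of lens-1's node
`HOME/decomp-schanuel-lens-1/g9/ArgumentLayer.lean` (rc 0 · 0 sorry · axioms standard).  For a ℚ-l.i. `z : Fin n → ℂ` write
`t = trdeg ℚ(z, e^z)`, `t₁ = trdeg ℚ(z)` (ARGUMENT degree), `t₂ = trdeg ℚ(e^z)` (VALUE degree).  This file proves, with NO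
item of the route as hypothesis:

* BIDEGREE CALCULUS of a span-minimal failure (the data of items 29645 / 30352 / 30353): tightness `t = n − 1`
  (`tight_of_spanMinimal`), `t₁, t₂ ≤ t ≤ n − 1`, entangled `⟹ 1 ≤ t₁, 1 ≤ t₂, t + 1 ≤ t₁ + t₂` (`bidegree_bounds`), the
  n = 3 TRICHOTOMY `(t₁, t₂) ∈ {(1,2), (2,1), (2,2)}` (`trichotomy_three`), and `n − 1 ≤ t₁ ⟹ t₁ = t` (`args_eq_total_of_full`);
* DECIDED CELLS of the round-9 piece 𝒜 «failing entangled atoms are argument-full» (its conclusion `n − 1 ≤ trdeg ℚ(z)` proved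
  outright on spans where Schanuel is open): the NESTERENKO cell (argument field ∋ π, e^π; modulo the tree's named fact
  `Literature.NumberTheory.Transcendental.nesterenko`, proved in the tree as `nesterenko_holds` — kept as a hypothesis only because that
  module tower has no hub olean; discharge = `… nesterenko_holds`) and the LINDEMANN–WEIERSTRASS cells (argument field ∋ e^{a_1}, …,
  e^{a_{n−1}}, a_j algebraic ℚ-l.i.; unconditional, all n); literal instances (iπ, π, e^π) and (1, e, e^α);
* CERTIFIED MEMBERS of 𝒜's class (arguments on a curve, `t₁ ≤ 1`), i.e. tuples that have LEFT the round-9 residual ℛ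
  «argument-full entangled atoms satisfy Schanuel»: the e-tower (1, e, e²), the Gel'fond–Diaz towers log α·(1, β, β²), (1, π, π²),
  and the general `not_argFull_of_args_on_curve`; plus the certificate that the e-tower is VALUE-FULL (`ℚ(z, e^z) = ℚ(e^z)`),
  the reason the argument side is cut first.

Defines nothing; cites `RootDecomp1EAnchor.{trdeg_adjoin_le_nat, trdeg_adjoin_le_of_isAlgebraic, isAlgebraic_of_mem_adjoin}`,
`OneMotiveToric.trdeg_mono`, `LindemannWeierstrass.AlgIndep_holds`.
[cite: NesterenkoPhilippon2001, Ch. 3 Cor. 1.2; Ch. 14 Thm 2.9] [cite: Waldschmidt2000, §1.4] [cite: BakerTNT1975, Ch. 1 Thm 1.4]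
-/

set_option linter.dupNamespace false

noncomputable section

namespace Summit.Schanuel.Schanuel.Theorems.RootDecomp1ArgumentCells

open Complex IntermediateField
open scoped BigOperators Cardinal
open Literature.NumberTheory.Transcendental (nesterenko)
open Literature.NumberTheory.Transcendental.OneMotiveToric (trdeg_mono)
open Summit.Schanuel.Schanuel.Theorems.RootDecomp1EAnchor (trdeg_adjoin_le_nat trdeg_adjoin_le_of_isAlgebraic
  isAlgebraic_of_mem_adjoin)

/-! ## §1  Toolkit -/

/-- `trdeg ℚ(z) ≤ trdeg ℚ(z, e^z)`. -/
theorem trdeg_args_le {n : ℕ} (z : Fin n → ℂ) :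
    Algebra.trdeg ℚ ↥(adjoin ℚ (Set.range z)) ≤
      Algebra.trdeg ℚ ↥(adjoin ℚ (Set.range z ∪ Set.range (Complex.exp ∘ z))) :=
  trdeg_mono (adjoin.mono ℚ _ _ Set.subset_union_left)

/-- `trdeg ℚ(e^z) ≤ trdeg ℚ(z, e^z)`. -/
theorem trdeg_vals_le {n : ℕ} (z : Fin n → ℂ) :
    Algebra.trdeg ℚ ↥(adjoin ℚ (Set.range (Complex.exp ∘ z))) ≤
      Algebra.trdeg ℚ ↥(adjoin ℚ (Set.range z ∪ Set.range (Complex.exp ∘ z))) :=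
  trdeg_mono (adjoin.mono ℚ _ _ Set.subset_union_right)

/-- An algebraically independent family over `ℚ` lying in `K` forces `m ≤ trdeg_ℚ K`. [folklore] -/
theorem le_trdeg_of_algebraicIndependent_mem (K : IntermediateField ℚ ℂ) {m : ℕ} {x : Fin m → ℂ}
    (hx : AlgebraicIndependent ℚ x) (hmem : ∀ i, x i ∈ K) : (m : Cardinal) ≤ Algebra.trdeg ℚ ↥K := by
  let y : Fin m → ↥K := fun i => ⟨x i, hmem i⟩
  have hy : AlgebraicIndependent ℚ y := AlgebraicIndependent.of_comp K.val hx
  have hle := hy.cardinalMk_le_trdeg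
  simp only [Cardinal.mk_fintype, Fintype.card_fin] at hle
  exact hle

/-- `trdeg ℚ(z) ≤ 1` as soon as every `zᵢ` is algebraic over a simple subfield `ℚ(θ)` (arguments on a curve). -/
theorem trdeg_args_le_one_of_isAlgebraic_adjoin_singleton {n : ℕ} (z : Fin n → ℂ) (θ : ℂ)
    (h : ∀ i, IsAlgebraic ↥(adjoin ℚ ({θ} : Set ℂ)) (z i)) :
    Algebra.trdeg ℚ ↥(adjoin ℚ (Set.range z)) ≤ 1 := by
  refine (trdeg_adjoin_le_of_isAlgebraic (K := adjoin ℚ ({θ} : Set ℂ)) ?_).trans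
    (trdeg_adjoin_le_nat (F := ℚ) ({θ} : Set ℂ) (n := 1) (by simp))
  rintro _ ⟨i, rfl⟩
  exact h i

/-! ## §2  Bidegree calculus of a tight atom: `t = n − 1`, `1 ≤ t₁, t₂ ≤ n − 1`, entangled `⟹ t₁ + t₂ ≥ n` -/

section Bidegree

variable {n : ℕ} {z : Fin n → ℂ}

/-- TIGHTNESS, lower half: span-minimality (the 29645/30352/30353 clause) at the sub-tuple `z ∘ castSucc` gives `n − 1 ≤ t`. -/
theorem pred_le_trdeg_of_spanMinimal (hz : LinearIndependent ℚ z)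
    (hmin : ∀ (m : ℕ), m < n → ∀ (w : Fin m → ℂ), LinearIndependent ℚ w →
      (∀ i, w i ∈ Submodule.span ℚ (Set.range z)) →
      (m : Cardinal) ≤ Algebra.trdeg ℚ ↥(IntermediateField.adjoin ℚ (Set.range w ∪ Set.range (Complex.exp ∘ w))))
    (hn : 1 ≤ n) :
    ((n - 1 : ℕ) : Cardinal) ≤ Algebra.trdeg ℚ ↥(adjoin ℚ (Set.range z ∪ Set.range (Complex.exp ∘ z))) := by
  obtain ⟨k, rfl⟩ : ∃ k, n = k + 1 := ⟨n - 1, by omega⟩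
  simp only [Nat.add_sub_cancel]
  let w : Fin k → ℂ := z ∘ Fin.castSucc
  have hw : LinearIndependent ℚ w := hz.comp _ (Fin.castSucc_injective k)
  have hwspan : ∀ i, w i ∈ Submodule.span ℚ (Set.range z) := fun i => Submodule.subset_span ⟨Fin.castSucc i, rfl⟩
  have h := hmin k (Nat.lt_succ_self k) w hw hwspan
  refine h.trans (trdeg_mono (adjoin.mono ℚ _ _ ?_))
  rintro x (⟨i, rfl⟩ | ⟨i, rfl⟩)
  · exact Or.inl ⟨Fin.castSucc i, rfl⟩
  · exact Or.inr ⟨Fin.castSucc i, rfl⟩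

/-- TIGHTNESS, upper half: a failure `t < n` has `t ≤ n − 1`. -/
theorem trdeg_le_pred_of_fail (hn : 1 ≤ n)
    (hlt : Algebra.trdeg ℚ ↥(adjoin ℚ (Set.range z ∪ Set.range (Complex.exp ∘ z))) < (n : Cardinal)) :
    Algebra.trdeg ℚ ↥(adjoin ℚ (Set.range z ∪ Set.range (Complex.exp ∘ z))) ≤ ((n - 1 : ℕ) : Cardinal) := by
  obtain ⟨k, rfl⟩ : ∃ k, n = k + 1 := ⟨n - 1, by omega⟩
  simp only [Nat.add_sub_cancel]
  have h' : Algebra.trdeg ℚ ↥(adjoin ℚ (Set.range z ∪ Set.range (Complex.exp ∘ z))) < (k : Cardinal) + 1 := by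
    exact_mod_cast hlt
  exact Cardinal.lt_natCast_add_one_iff.mp h'

/-- TIGHTNESS: a span-minimal failure has `trdeg ℚ(z, e^z) = n − 1`. -/
theorem tight_of_spanMinimal (hz : LinearIndependent ℚ z)
    (hmin : ∀ (m : ℕ), m < n → ∀ (w : Fin m → ℂ), LinearIndependent ℚ w →
      (∀ i, w i ∈ Submodule.span ℚ (Set.range z)) →
      (m : Cardinal) ≤ Algebra.trdeg ℚ ↥(IntermediateField.adjoin ℚ (Set.range w ∪ Set.range (Complex.exp ∘ w))))
    (hn : 1 ≤ n) (hlt : Algebra.trdeg ℚ ↥(adjoin ℚ (Set.range z ∪ Set.range (Complex.exp ∘ z))) < (n : Cardinal)) :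
    Algebra.trdeg ℚ ↥(adjoin ℚ (Set.range z ∪ Set.range (Complex.exp ∘ z))) = ((n - 1 : ℕ) : Cardinal) :=
  le_antisymm (trdeg_le_pred_of_fail hn hlt) (pred_le_trdeg_of_spanMinimal hz hmin hn)

/-- The three degrees of a failing tuple are naturals `≤ n − 1` with `t₁, t₂ ≤ t`; an ENTANGLED one has `1 ≤ t₁`, `1 ≤ t₂`
and `t + 1 ≤ t₁ + t₂` (pure cardinal bookkeeping). -/
theorem bidegree_bounds (hn : 1 ≤ n)
    (hlt : Algebra.trdeg ℚ ↥(adjoin ℚ (Set.range z ∪ Set.range (Complex.exp ∘ z))) < (n : Cardinal))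
    (hent : Algebra.trdeg ℚ ↥(adjoin ℚ (Set.range z ∪ Set.range (Complex.exp ∘ z))) <
      Algebra.trdeg ℚ ↥(adjoin ℚ (Set.range z)) + Algebra.trdeg ℚ ↥(adjoin ℚ (Set.range (Complex.exp ∘ z)))) :
    ∃ kt k₁ k₂ : ℕ, Algebra.trdeg ℚ ↥(adjoin ℚ (Set.range z ∪ Set.range (Complex.exp ∘ z))) = kt ∧
      Algebra.trdeg ℚ ↥(adjoin ℚ (Set.range z)) = k₁ ∧
      Algebra.trdeg ℚ ↥(adjoin ℚ (Set.range (Complex.exp ∘ z))) = k₂ ∧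
      kt ≤ n - 1 ∧ k₁ ≤ kt ∧ k₂ ≤ kt ∧ 1 ≤ k₁ ∧ 1 ≤ k₂ ∧ kt + 1 ≤ k₁ + k₂ := by
  have ht := trdeg_le_pred_of_fail hn hlt
  have h1 := trdeg_args_le z
  have h2 := trdeg_vals_le z
  obtain ⟨kt, hkt⟩ := Cardinal.lt_aleph0.1 (lt_of_le_of_lt ht Cardinal.natCast_lt_aleph0)
  obtain ⟨k₁, hk₁⟩ := Cardinal.lt_aleph0.1 (lt_of_le_of_lt (h1.trans ht) Cardinal.natCast_lt_aleph0)
  obtain ⟨k₂, hk₂⟩ := Cardinal.lt_aleph0.1 (lt_of_le_of_lt (h2.trans ht) Cardinal.natCast_lt_aleph0)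
  refine ⟨kt, k₁, k₂, hkt, hk₁, hk₂, ?_, ?_, ?_, ?_, ?_, ?_⟩
  · rw [hkt] at ht; exact_mod_cast ht
  · rw [hkt, hk₁] at h1; exact_mod_cast h1
  · rw [hkt, hk₂] at h2; exact_mod_cast h2
  · rw [hkt, hk₁, hk₂] at hent; rw [hkt, hk₂] at h2
    have h' : kt < k₁ + k₂ := by exact_mod_cast hent
    have h2' : k₂ ≤ kt := by exact_mod_cast h2
    omega
  · rw [hkt, hk₁, hk₂] at hent; rw [hkt, hk₁] at h1
    have h' : kt < k₁ + k₂ := by exact_mod_cast hent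
    have h1' : k₁ ≤ kt := by exact_mod_cast h1
    omega
  · rw [hkt, hk₁, hk₂] at hent
    have h' : kt < k₁ + k₂ := by exact_mod_cast hent
    omega

/-- THE n = 3 TRICHOTOMY: a span-minimal entangled failure of length 3 has `trdeg ℚ(z, e^z) = 2` and bidegree
`(trdeg ℚ(z), trdeg ℚ(e^z)) ∈ {(1,2), (2,1), (2,2)}` — «arguments on a curve» | «values on a curve» | «interalgebraic». -/
theorem trichotomy_three {z : Fin 3 → ℂ} (hz : LinearIndependent ℚ z)
    (hmin : ∀ (m : ℕ), m < 3 → ∀ (w : Fin m → ℂ), LinearIndependent ℚ w →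
      (∀ i, w i ∈ Submodule.span ℚ (Set.range z)) →
      (m : Cardinal) ≤ Algebra.trdeg ℚ ↥(IntermediateField.adjoin ℚ (Set.range w ∪ Set.range (Complex.exp ∘ w))))
    (hlt : Algebra.trdeg ℚ ↥(adjoin ℚ (Set.range z ∪ Set.range (Complex.exp ∘ z))) < ((3 : ℕ) : Cardinal))
    (hent : Algebra.trdeg ℚ ↥(adjoin ℚ (Set.range z ∪ Set.range (Complex.exp ∘ z))) <
      Algebra.trdeg ℚ ↥(adjoin ℚ (Set.range z)) + Algebra.trdeg ℚ ↥(adjoin ℚ (Set.range (Complex.exp ∘ z)))) :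
    Algebra.trdeg ℚ ↥(adjoin ℚ (Set.range z ∪ Set.range (Complex.exp ∘ z))) = 2 ∧
      ((Algebra.trdeg ℚ ↥(adjoin ℚ (Set.range z)) = 1 ∧ Algebra.trdeg ℚ ↥(adjoin ℚ (Set.range (Complex.exp ∘ z))) = 2) ∨
       (Algebra.trdeg ℚ ↥(adjoin ℚ (Set.range z)) = 2 ∧ Algebra.trdeg ℚ ↥(adjoin ℚ (Set.range (Complex.exp ∘ z))) = 1) ∨
       (Algebra.trdeg ℚ ↥(adjoin ℚ (Set.range z)) = 2 ∧ Algebra.trdeg ℚ ↥(adjoin ℚ (Set.range (Complex.exp ∘ z))) = 2)) := by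
  have htight := tight_of_spanMinimal hz hmin (by norm_num) hlt
  obtain ⟨kt, k₁, k₂, hkt, hk₁, hk₂, hle, h1, h2, h1', h2', hsum⟩ := bidegree_bounds (by norm_num) hlt hent
  have hkt2 : kt = 2 := by
    rw [hkt] at htight
    have : (kt : Cardinal) = ((2 : ℕ) : Cardinal) := by simpa using htight
    exact_mod_cast this
  subst hkt2
  refine ⟨by rw [hkt]; norm_cast, ?_⟩
  rw [hk₁, hk₂]
  have : (k₁ = 1 ∧ k₂ = 2) ∨ (k₁ = 2 ∧ k₂ = 1) ∨ (k₁ = 2 ∧ k₂ = 2) := by omega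
  rcases this with ⟨rfl, rfl⟩ | ⟨rfl, rfl⟩ | ⟨rfl, rfl⟩
  · exact Or.inl ⟨by norm_cast, by norm_cast⟩
  · exact Or.inr (Or.inl ⟨by norm_cast, by norm_cast⟩)
  · exact Or.inr (Or.inr ⟨by norm_cast, by norm_cast⟩)

/-- Under a failure, ℛ's inserted hypothesis «full argument degree» says the VALUES ARE ALGEBRAIC OVER THE ARGUMENTS:
`trdeg ℚ(z) = trdeg ℚ(z, e^z)`. -/
theorem args_eq_total_of_full (hn : 1 ≤ n)
    (hlt : Algebra.trdeg ℚ ↥(adjoin ℚ (Set.range z ∪ Set.range (Complex.exp ∘ z))) < (n : Cardinal))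
    (hfull : ((n - 1 : ℕ) : Cardinal) ≤ Algebra.trdeg ℚ ↥(adjoin ℚ (Set.range z))) :
    Algebra.trdeg ℚ ↥(adjoin ℚ (Set.range z)) =
      Algebra.trdeg ℚ ↥(adjoin ℚ (Set.range z ∪ Set.range (Complex.exp ∘ z))) :=
  le_antisymm (trdeg_args_le z) ((trdeg_le_pred_of_fail hn hlt).trans hfull)

end Bidegree

/-! ## §3  DECIDED CELLS of the round-9 piece 𝒜 (conclusion `n − 1 ≤ trdeg ℚ(z)` proved outright) -/

/-- Nesterenko 1996 restricted to `(π, e^π)` and pushed into `ℂ`, modulo the tree's named fact `nesterenko`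
(PROVED in the tree: `Literature.NumberTheory.Transcendental.nesterenko_holds`; discharge = `algebraicIndependent_pi_exp_pi
nesterenko_holds`).  Transport as in `Theorems/AclSubsetLogFreeCore/Negative/ExpAclDefinability.lean`.
[cite: NesterenkoPhilippon2001, Ch. 3 Corollary 1.2] [cite: Nesterenko1996SbMath, Theorem 1, Corollary] -/
theorem algebraicIndependent_pi_exp_pi (hN : nesterenko) :
    AlgebraicIndependent ℚ ![(Real.pi : ℂ), Complex.exp Real.pi] := by
  have h3 : AlgebraicIndependent ℚ ![Real.pi, Real.exp Real.pi, Real.Gamma (1 / 4)] := hN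
  have h2 : AlgebraicIndependent ℚ ![Real.pi, Real.exp Real.pi] := by
    have := h3.comp Fin.castSucc (Fin.castSucc_injective 2)
    convert this using 1
    ext i; fin_cases i <;> rfl
  have hf : Function.Injective ((Complex.ofRealHom).toRatAlgHom) := fun a b h =>
    Complex.ofReal_injective (by simpa using h)
  have hmap := h2.map' (f := (Complex.ofRealHom).toRatAlgHom) hf
  convert hmap using 1
  ext i; fin_cases i <;> simp [Complex.ofReal_exp]

/-- NESTERENKO CELL (all n): a span whose argument field contains `π` and `e^π` has argument degree ≥ 2. -/
theorem two_le_argDegree_of_pi_expPi_mem (hN : nesterenko) {n : ℕ} (z : Fin n → ℂ)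
    (hπ : (Real.pi : ℂ) ∈ adjoin ℚ (Set.range z)) (he : Complex.exp Real.pi ∈ adjoin ℚ (Set.range z)) :
    (2 : Cardinal) ≤ Algebra.trdeg ℚ ↥(adjoin ℚ (Set.range z)) := by
  have h := le_trdeg_of_algebraicIndependent_mem (adjoin ℚ (Set.range z)) (algebraicIndependent_pi_exp_pi hN)
    (fun i => by fin_cases i <;> simp [hπ, he])
  simpa using h

/-- 𝒜 DECIDED on the Nesterenko cell at n = 3: `((3 − 1 : ℕ) : Cardinal) ≤ trdeg ℚ(z)` for EVERY `z : Fin 3 → ℂ` whose argument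
field contains `π, e^π` (spans of (iπ, π, e^π), (1, π, e^π), (log 2, π, e^π), (π, e^π, e^{e^π})); Schanuel is OPEN on each. -/
theorem argFull_three_of_pi_expPi_mem (hN : nesterenko) (z : Fin 3 → ℂ)
    (hπ : (Real.pi : ℂ) ∈ adjoin ℚ (Set.range z)) (he : Complex.exp Real.pi ∈ adjoin ℚ (Set.range z)) :
    ((3 - 1 : ℕ) : Cardinal) ≤ Algebra.trdeg ℚ ↥(IntermediateField.adjoin ℚ (Set.range z)) := by
  simpa using two_le_argDegree_of_pi_expPi_mem hN z hπ he

/-- LINDEMANN–WEIERSTRASS CELLS (all n, m; unconditional): a span whose argument field contains `e^{a₁}, …, e^{a_m}` with `aⱼ`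
algebraic and ℚ-linearly independent has argument degree ≥ m. -/
theorem le_argDegree_of_exp_algebraic_mem {n m : ℕ} (z : Fin n → ℂ) (a : Fin m → ℂ)
    (halg : ∀ j, IsAlgebraic ℚ (a j)) (hli : LinearIndependent ℚ a)
    (hmem : ∀ j, Complex.exp (a j) ∈ adjoin ℚ (Set.range z)) :
    (m : Cardinal) ≤ Algebra.trdeg ℚ ↥(adjoin ℚ (Set.range z)) :=
  le_trdeg_of_algebraicIndependent_mem (adjoin ℚ (Set.range z))
    (Literature.NumberTheory.Transcendental.LindemannWeierstrass.AlgIndep_holds m a halg hli) hmem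

/-- 𝒜 DECIDED on the Lindemann–Weierstrass cells (every n): `n − 1 ≤ trdeg ℚ(z)` for every `z : Fin n → ℂ` whose argument field
contains `n − 1` exponentials of ℚ-l.i. algebraic numbers; Schanuel is OPEN there (e.g. (1, e, e^{√2})). -/
theorem argFull_of_exp_algebraic_mem {n : ℕ} (z : Fin n → ℂ) (a : Fin (n - 1) → ℂ)
    (halg : ∀ j, IsAlgebraic ℚ (a j)) (hli : LinearIndependent ℚ a)
    (hmem : ∀ j, Complex.exp (a j) ∈ adjoin ℚ (Set.range z)) :
    ((n - 1 : ℕ) : Cardinal) ≤ Algebra.trdeg ℚ ↥(IntermediateField.adjoin ℚ (Set.range z)) :=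
  le_argDegree_of_exp_algebraic_mem z a halg hli hmem

/-- Literal instance: `(iπ, π, e^π)` is argument-full (modulo `nesterenko`). -/
theorem argFull_ipi_pi_expPi (hN : nesterenko) :
    ((3 - 1 : ℕ) : Cardinal) ≤
      Algebra.trdeg ℚ ↥(IntermediateField.adjoin ℚ (Set.range ![(Real.pi : ℂ) * I, (Real.pi : ℂ), Complex.exp Real.pi])) :=
  argFull_three_of_pi_expPi_mem hN _ (subset_adjoin ℚ _ ⟨1, rfl⟩) (subset_adjoin ℚ _ ⟨2, rfl⟩)

/-- Literal instance (unconditional): `(1, e, e^α)` with `α` algebraic, `1, α` ℚ-l.i., is argument-full. -/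
theorem argFull_one_e_expAlg (α : ℂ) (hα : IsAlgebraic ℚ α) (hli : LinearIndependent ℚ ![(1 : ℂ), α]) :
    ((3 - 1 : ℕ) : Cardinal) ≤
      Algebra.trdeg ℚ ↥(IntermediateField.adjoin ℚ (Set.range ![(1 : ℂ), Complex.exp 1, Complex.exp α])) := by
  refine argFull_of_exp_algebraic_mem _ ![(1 : ℂ), α] (fun j => ?_) hli (fun j => ?_)
  · fin_cases j
    · exact isAlgebraic_one
    · exact hα
  · fin_cases j
    · exact subset_adjoin ℚ _ ⟨1, rfl⟩
    · exact subset_adjoin ℚ _ ⟨2, rfl⟩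

/-! ## §4  CERTIFIED MEMBERS of 𝒜's class (arguments on a curve): they have LEFT the round-9 residual -/

/-- The e-tower `(1, e, e²)` has argument degree ≤ 1. -/
theorem eTower_argDegree_le_one :
    Algebra.trdeg ℚ ↥(adjoin ℚ (Set.range ![(1 : ℂ), Complex.exp 1, Complex.exp 1 ^ 2])) ≤ 1 := by
  refine trdeg_args_le_one_of_isAlgebraic_adjoin_singleton _ (Complex.exp 1) fun i => ?_
  have he : Complex.exp 1 ∈ adjoin ℚ ({Complex.exp 1} : Set ℂ) := subset_adjoin ℚ _ rfl
  fin_cases i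
  · exact isAlgebraic_of_mem_adjoin (one_mem _)
  · exact isAlgebraic_of_mem_adjoin he
  · exact isAlgebraic_of_mem_adjoin (pow_mem he 2)

/-- Hence the e-tower violates ℛ's inserted hypothesis `((3 − 1 : ℕ) : Cardinal) ≤ trdeg ℚ(z)`. -/
theorem eTower_not_argFull :
    ¬ ((3 - 1 : ℕ) : Cardinal) ≤ Algebra.trdeg ℚ ↥(adjoin ℚ (Set.range ![(1 : ℂ), Complex.exp 1, Complex.exp 1 ^ 2])) := by
  intro h
  have h2 : (2 : Cardinal) ≤ 1 := (by simpa using h : (2 : Cardinal) ≤ _).trans eTower_argDegree_le_one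
  exact absurd h2 (by norm_num)

/-- Gel'fond–Diaz towers `ℓ · (1, β, β²)` (`β` algebraic; `ℓ = log α`) have argument degree ≤ 1. -/
theorem gelfondTower_argDegree_le_one {ℓ β : ℂ} (hβ : IsAlgebraic ℚ β) :
    Algebra.trdeg ℚ ↥(adjoin ℚ (Set.range ![ℓ, β * ℓ, β ^ 2 * ℓ])) ≤ 1 := by
  refine trdeg_args_le_one_of_isAlgebraic_adjoin_singleton _ ℓ fun i => ?_
  have hℓ : IsAlgebraic ↥(adjoin ℚ ({ℓ} : Set ℂ)) ℓ := isAlgebraic_of_mem_adjoin (subset_adjoin ℚ _ rfl)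
  have hβ' : IsAlgebraic ↥(adjoin ℚ ({ℓ} : Set ℂ)) β := hβ.tower_top _
  fin_cases i
  · exact hℓ
  · exact hβ'.mul hℓ
  · exact (hβ'.pow 2).mul hℓ

/-- `(1, π, π²)` has argument degree ≤ 1. -/
theorem piTower_argDegree_le_one :
    Algebra.trdeg ℚ ↥(adjoin ℚ (Set.range ![(1 : ℂ), (Real.pi : ℂ), (Real.pi : ℂ) ^ 2])) ≤ 1 := by
  refine trdeg_args_le_one_of_isAlgebraic_adjoin_singleton _ (Real.pi : ℂ) fun i => ?_
  have hπ : (Real.pi : ℂ) ∈ adjoin ℚ ({(Real.pi : ℂ)} : Set ℂ) := subset_adjoin ℚ _ rfl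
  fin_cases i
  · exact isAlgebraic_of_mem_adjoin (one_mem _)
  · exact isAlgebraic_of_mem_adjoin hπ
  · exact isAlgebraic_of_mem_adjoin (pow_mem hπ 2)

/-- ARGUMENTS ON A CURVE never meet the round-9 residual at n = 3. -/
theorem not_argFull_of_args_on_curve (z : Fin 3 → ℂ) (θ : ℂ)
    (h : ∀ i, IsAlgebraic ↥(adjoin ℚ ({θ} : Set ℂ)) (z i)) :
    ¬ ((3 - 1 : ℕ) : Cardinal) ≤ Algebra.trdeg ℚ ↥(IntermediateField.adjoin ℚ (Set.range z)) := by
  intro hfull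
  have h2 : (2 : Cardinal) ≤ 1 :=
    (by simpa using hfull : (2 : Cardinal) ≤ _).trans (trdeg_args_le_one_of_isAlgebraic_adjoin_singleton z θ h)
  exact absurd h2 (by norm_num)

/-! ## §5  Why the argument side first: the e-tower is VALUE-FULL -/

/-- `ℚ(z, e^z) = ℚ(e^z)` for the e-tower `z = (1, e, e²)`. -/
theorem eTower_valueField_eq_total :
    adjoin ℚ (Set.range ![(1 : ℂ), Complex.exp 1, Complex.exp 1 ^ 2] ∪
        Set.range (Complex.exp ∘ ![(1 : ℂ), Complex.exp 1, Complex.exp 1 ^ 2])) =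
      adjoin ℚ (Set.range (Complex.exp ∘ ![(1 : ℂ), Complex.exp 1, Complex.exp 1 ^ 2])) := by
  refine le_antisymm (adjoin_le_iff.mpr ?_) (adjoin.mono ℚ _ _ Set.subset_union_right)
  have he : Complex.exp 1 ∈ adjoin ℚ (Set.range (Complex.exp ∘ ![(1 : ℂ), Complex.exp 1, Complex.exp 1 ^ 2])) :=
    subset_adjoin ℚ _ ⟨0, by simp⟩
  rintro x (⟨i, rfl⟩ | hx)
  · fin_cases i
    · exact one_mem _
    · exact he
    · exact pow_mem he 2
  · exact subset_adjoin ℚ _ hx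

/-- Value degree = total degree for the e-tower. -/
theorem eTower_valDegree_eq_total :
    Algebra.trdeg ℚ ↥(adjoin ℚ (Set.range (Complex.exp ∘ ![(1 : ℂ), Complex.exp 1, Complex.exp 1 ^ 2]))) =
      Algebra.trdeg ℚ ↥(adjoin ℚ (Set.range ![(1 : ℂ), Complex.exp 1, Complex.exp 1 ^ 2] ∪
        Set.range (Complex.exp ∘ ![(1 : ℂ), Complex.exp 1, Complex.exp 1 ^ 2]))) := by
  rw [eTower_valueField_eq_total]

/-- LW cells on the VALUE side (for the round-10 preview): value degree ≥ m on spans whose value field contains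
`e^{a₁}, …, e^{a_m}`, `aⱼ ∈ ℚ̄` ℚ-l.i. -/
theorem le_valDegree_of_exp_algebraic_mem {n m : ℕ} (z : Fin n → ℂ) (a : Fin m → ℂ)
    (halg : ∀ j, IsAlgebraic ℚ (a j)) (hli : LinearIndependent ℚ a)
    (hmem : ∀ j, Complex.exp (a j) ∈ adjoin ℚ (Set.range (Complex.exp ∘ z))) :
    (m : Cardinal) ≤ Algebra.trdeg ℚ ↥(adjoin ℚ (Set.range (Complex.exp ∘ z))) :=
  le_trdeg_of_algebraicIndependent_mem _
    (Literature.NumberTheory.Transcendental.LindemannWeierstrass.AlgIndep_holds m a halg hli) hmem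

end Summit.Schanuel.Schanuel.Theorems.RootDecomp1ArgumentCells
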